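import Literature.NumberTheory.Sieve.LinearDispersionPoisson
import Literature.NumberTheory.Sieve.BombieriVinogradovReduction
import HarnessLib

/-!
# Linnik dispersion for `u ∣ A d m + B`: the engine (sum over the moduli)

Topic `Literature/NumberTheory/Sieve` (the dispersion method; E. Bombieri, J. B. Friedlander,
H. Iwaniec, *Primes in arithmetic progressions to large moduli*, Acta Math. 156 (1986), §3
(3.6)–(3.8), §6, §9, with Weil's bound for the incomplete Kloosterman sums).  Last file of the
chain `LFunctions/DispersionKloostermanPhases` → `LFunctions/DispersionFourierDecay` →
`LinearDispersionPoisson` → this file.  It sums the one-pair dispersion bound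
`LD_pair_dispersion_le` over the moduli `u, u' ∈ U ⊆ (P, 2P]` (squarefree, coprime to `A B Q`,
`τ(u) ≤ T`) against coefficients `|α_u| ≤ 1`, controlling the gcd sums `∑_{u,u'} (u,u')` and
`∑_{u,u'} (u,u')³` that arise.  Written as the engine of the dispersion (middle) range of the
linear pair window of the polynomial Möbius tail (crux `PolyMobiusTail`, summit Parity/BatemanHorn);
nothing here refers to it.  Everything is PROVED; no definitions, no named facts.

* `LD_pair_bound_le` — simplification of the one-pair bound for `u, u' ∈ (P, 2P]`, `τ ≤ T`.
* `LD_card_filter_dvd_le` (`#{u ∈ U : g ∣ u} ≤ 3P/g`), `LD_sum_pairs_gcd_le`,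
  `LD_sum_pairs_gcd_one_le`, `LD_sum_pairs_gcd_cube_le`, `LD_sum_sum_gcd_le`
  (`∑_{u,u' ∈ U} (u,u') ≤ 9 P² (1 + log 2P)`), `LD_sum_sum_gcd_cube_le` (`∑ (u,u')³ ≤ 36 P⁴`),
  `LD_final_numeric` (collecting terms).
* **`LD_dispersion_engine_nat`** (`A ≥ 0`) and **`LD_dispersion_engine`** (`A ≠ 0`): with
  `𝒟 = ∑_{d ≡ c_d (Q)} F(d) |∑_u α_u ∑_y [u ∣ A d m + B]|²`, `m = c_m + Qy`, and
  `MT = (∫F)/Q · ∑_{u,u'} α_u ᾱ_{u'} N(u,u')/[u,u']`,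
  `N(u,u') = #{(y,y') : (m,u) = (m',u') = 1, m ≡ m' (mod (u,u'))}`, one has
  `|𝒟 − MT| ≤ K T⁴ (1 + log 2PQR)³ ((Q(y₂−y₁+1))² + P³)` with `K = 2448 √(C₀C₂) + 1`.

## References

* E. Bombieri, J. B. Friedlander, H. Iwaniec, Acta Math. 156 (1986), 203–251, §§3, 6, 9.
  [BombieriFriedlanderIwaniecActa1986]
* Yu. V. Linnik, *The dispersion method in binary additive problems* (AMS, 1963) — the method.
-/

noncomputable section

open Finset Real MeasureTheory
open scoped FourierTransform ContDiff ArithmeticFunction.sigma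

namespace Literature.NumberTheory.Sieve

open Literature.NumberTheory.LFunctions

/-! ## Summing the pair bounds over `u, u' ∈ U` -/

/-- **Simplifying the pair bound.**  For `u = e u₁`, `u' = e v` in `(P, 2P]` with
`(u₁, v) = 1`, `τ(u), τ(u') ≤ T` (`P, T ≥ 1`), `Y₀ ≥ 0` and `C ≥ 0`:
`C τ(u₁v) · e (((Y₀/e+2)/u₁ + τ(u₁)√u₁(1+log u₁)) (((Y₀/e+2)/v + τ(v)√v(1+log v))`
`≤ C T² ((4eY₀² + 16e³)/P² + 4 e T² (1 + log 2P)² P)`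
(`(Y₀/e+2)/u₁ = (Y₀+2e)/u ≤ (Y₀+2e)/P`, `u₁ ≤ 2P`, `τ(u₁) ≤ τ(u) ≤ T`, and
`(a+b)² ≤ 2a² + 2b²`). [folklore] -/
theorem LD_pair_bound_le {u u' e u₁ v : ℕ} {P T C Y₀ : ℝ} (hP : 1 ≤ P) (hT : 1 ≤ T) (hC : 0 ≤ C)
    (hY₀ : 0 ≤ Y₀) (hue : u = e * u₁) (hu'e : u' = e * v) (he0 : 0 < e) (hu₁0 : 0 < u₁)
    (hv0 : 0 < v) (hu₁v : u₁.Coprime v)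
    (hPu : P < (u : ℝ)) (huP : (u : ℝ) ≤ 2 * P) (hPu' : P < (u' : ℝ)) (hu'P : (u' : ℝ) ≤ 2 * P)
    (hτu : ((Nat.divisors u).card : ℝ) ≤ T) (hτu' : ((Nat.divisors u').card : ℝ) ≤ T) :
    C * ((Nat.divisors (u₁ * v)).card : ℝ) *
        ((e : ℝ) *
          ((Y₀ / (e : ℝ) + 2) / (u₁ : ℝ) +
            (Nat.divisors u₁).card * Real.sqrt (u₁ : ℝ) * (1 + Real.log (u₁ : ℝ))) *
          ((Y₀ / (e : ℝ) + 2) / (v : ℝ) +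
            (Nat.divisors v).card * Real.sqrt (v : ℝ) * (1 + Real.log (v : ℝ)))) ≤
      C * T ^ 2 * ((4 * (e : ℝ) * Y₀ ^ 2 + 16 * (e : ℝ) ^ 3) / P ^ 2 +
        4 * (e : ℝ) * T ^ 2 * (1 + Real.log (2 * P)) ^ 2 * P) := by
  have hu0 : 0 < u := by rw [hue]; exact Nat.mul_pos he0 hu₁0
  have hu'0 : 0 < u' := by rw [hu'e]; exact Nat.mul_pos he0 hv0
  have hu₁u : u₁ ∣ u := ⟨e, by rw [mul_comm]; exact hue⟩
  have hvu' : v ∣ u' := ⟨e, by rw [mul_comm]; exact hu'e⟩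
  -- real versions
  have hP0 : 0 < P := by linarith
  have heR : (1 : ℝ) ≤ e := by exact_mod_cast he0
  have he0R : (0 : ℝ) < e := by linarith
  have hu₁R : (1 : ℝ) ≤ u₁ := by exact_mod_cast hu₁0
  have hvR : (1 : ℝ) ≤ v := by exact_mod_cast hv0
  have hueR : (e : ℝ) * u₁ = u := by rw [← Nat.cast_mul, ← hue]
  have hu'eR : (e : ℝ) * v = u' := by rw [← Nat.cast_mul, ← hu'e]
  have hu₁le : (u₁ : ℝ) ≤ 2 * P := le_trans (by exact_mod_cast Nat.le_of_dvd hu0 hu₁u) huP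
  have hvle : (v : ℝ) ≤ 2 * P := le_trans (by exact_mod_cast Nat.le_of_dvd hu'0 hvu') hu'P
  have hℓ₀1 : 1 ≤ 1 + Real.log (2 * P) := by
    have := Real.log_nonneg (show (1 : ℝ) ≤ 2 * P by linarith); linarith
  have hlogu₁ : 1 + Real.log (u₁ : ℝ) ≤ 1 + Real.log (2 * P) := by
    have := Real.log_le_log (by linarith) hu₁le; linarith
  have hlogv : 1 + Real.log (v : ℝ) ≤ 1 + Real.log (2 * P) := by
    have := Real.log_le_log (by linarith) hvle; linarith
  have hlogu₁0 : 0 ≤ 1 + Real.log (u₁ : ℝ) := by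
    have := Real.log_nonneg hu₁R; linarith
  have hlogv0 : 0 ≤ 1 + Real.log (v : ℝ) := by
    have := Real.log_nonneg hvR; linarith
  have hsqu₁ : Real.sqrt (u₁ : ℝ) ≤ Real.sqrt (2 * P) := Real.sqrt_le_sqrt hu₁le
  have hsqv : Real.sqrt (v : ℝ) ≤ Real.sqrt (2 * P) := Real.sqrt_le_sqrt hvle
  have hτu₁ : ((Nat.divisors u₁).card : ℝ) ≤ T :=
    le_trans (by exact_mod_cast Finset.card_le_card (Nat.divisors_subset_of_dvd hu0.ne' hu₁u)) hτu
  have hτv : ((Nat.divisors v).card : ℝ) ≤ T :=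
    le_trans (by exact_mod_cast Finset.card_le_card (Nat.divisors_subset_of_dvd hu'0.ne' hvu')) hτu'
  have hT0 : 0 ≤ T := by linarith
  have hτ : ((Nat.divisors (u₁ * v)).card : ℝ) ≤ T ^ 2 := by
    rw [Nat.Coprime.card_divisors_mul hu₁v, Nat.cast_mul, sq]
    exact mul_le_mul hτu₁ hτv (Nat.cast_nonneg _) hT0
  -- the two brackets are `≤ β = (Y₀+2e)/P + T √(2P) (1 + log 2P)`
  have hsq0 : 0 ≤ Real.sqrt (2 * P) := Real.sqrt_nonneg _
  have hβ0 : 0 ≤ (Y₀ + 2 * e) / P + T * Real.sqrt (2 * P) * (1 + Real.log (2 * P)) := by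
    have h1 : 0 ≤ (Y₀ + 2 * e) / P := div_nonneg (by linarith) hP0.le
    have h2 : 0 ≤ T * Real.sqrt (2 * P) * (1 + Real.log (2 * P)) :=
      mul_nonneg (mul_nonneg hT0 hsq0) (by linarith)
    linarith
  have hB₁ : (Y₀ / (e : ℝ) + 2) / (u₁ : ℝ) +
      (Nat.divisors u₁).card * Real.sqrt (u₁ : ℝ) * (1 + Real.log (u₁ : ℝ)) ≤
      (Y₀ + 2 * e) / P + T * Real.sqrt (2 * P) * (1 + Real.log (2 * P)) := by
    refine add_le_add ?_ ?_
    · rw [show (Y₀ / (e : ℝ) + 2) / (u₁ : ℝ) = (Y₀ + 2 * e) / ((e : ℝ) * u₁) by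
        field_simp, hueR]
      exact div_le_div_of_nonneg_left (by linarith) hP0 hPu.le
    · exact mul_le_mul (mul_le_mul hτu₁ hsqu₁ (Real.sqrt_nonneg _) hT0) hlogu₁ hlogu₁0
        (mul_nonneg hT0 hsq0)
  have hB₂ : (Y₀ / (e : ℝ) + 2) / (v : ℝ) +
      (Nat.divisors v).card * Real.sqrt (v : ℝ) * (1 + Real.log (v : ℝ)) ≤
      (Y₀ + 2 * e) / P + T * Real.sqrt (2 * P) * (1 + Real.log (2 * P)) := by
    refine add_le_add ?_ ?_
    · rw [show (Y₀ / (e : ℝ) + 2) / (v : ℝ) = (Y₀ + 2 * e) / ((e : ℝ) * v) by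
        field_simp, hu'eR]
      exact div_le_div_of_nonneg_left (by linarith) hP0 hPu'.le
    · exact mul_le_mul (mul_le_mul hτv hsqv (Real.sqrt_nonneg _) hT0) hlogv hlogv0
        (mul_nonneg hT0 hsq0)
  have hB₁0 : 0 ≤ (Y₀ / (e : ℝ) + 2) / (u₁ : ℝ) +
      (Nat.divisors u₁).card * Real.sqrt (u₁ : ℝ) * (1 + Real.log (u₁ : ℝ)) := by
    have h1 : 0 ≤ (Y₀ / (e : ℝ) + 2) / (u₁ : ℝ) :=
      div_nonneg (by have := div_nonneg hY₀ he0R.le; linarith) (by linarith)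
    have h2 : 0 ≤ (Nat.divisors u₁).card * Real.sqrt (u₁ : ℝ) * (1 + Real.log (u₁ : ℝ)) :=
      mul_nonneg (mul_nonneg (Nat.cast_nonneg _) (Real.sqrt_nonneg _)) hlogu₁0
    linarith
  have hB₂0 : 0 ≤ (Y₀ / (e : ℝ) + 2) / (v : ℝ) +
      (Nat.divisors v).card * Real.sqrt (v : ℝ) * (1 + Real.log (v : ℝ)) := by
    have h1 : 0 ≤ (Y₀ / (e : ℝ) + 2) / (v : ℝ) :=
      div_nonneg (by have := div_nonneg hY₀ he0R.le; linarith) (by linarith)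
    have h2 : 0 ≤ (Nat.divisors v).card * Real.sqrt (v : ℝ) * (1 + Real.log (v : ℝ)) :=
      mul_nonneg (mul_nonneg (Nat.cast_nonneg _) (Real.sqrt_nonneg _)) hlogv0
    linarith
  -- `e β² ≤ (4eY₀² + 16e³)/P² + 4eT²ℓ₀²P`
  have hsq2P : Real.sqrt (2 * P) ^ 2 = 2 * P := Real.sq_sqrt (by linarith)
  have hβsq : ((Y₀ + 2 * e) / P + T * Real.sqrt (2 * P) * (1 + Real.log (2 * P))) ^ 2 ≤
      (4 * Y₀ ^ 2 + 16 * (e : ℝ) ^ 2) / P ^ 2 + 4 * T ^ 2 * (1 + Real.log (2 * P)) ^ 2 * P := by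
    have h1 : ((Y₀ + 2 * e) / P + T * Real.sqrt (2 * P) * (1 + Real.log (2 * P))) ^ 2 ≤
        2 * ((Y₀ + 2 * e) / P) ^ 2 + 2 * (T * Real.sqrt (2 * P) * (1 + Real.log (2 * P))) ^ 2 := by
      have h := sq_nonneg ((Y₀ + 2 * e) / P - T * Real.sqrt (2 * P) * (1 + Real.log (2 * P)))
      linarith [h]
    have h2 : (Y₀ + 2 * (e : ℝ)) ^ 2 ≤ 2 * Y₀ ^ 2 + 8 * (e : ℝ) ^ 2 := by
      have h := sq_nonneg (Y₀ - 2 * e)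
      linarith [h]
    have h3 : 2 * ((Y₀ + 2 * e) / P) ^ 2 ≤ (4 * Y₀ ^ 2 + 16 * (e : ℝ) ^ 2) / P ^ 2 := by
      rw [div_pow, show (4 * Y₀ ^ 2 + 16 * (e : ℝ) ^ 2) / P ^ 2 =
        2 * ((2 * Y₀ ^ 2 + 8 * (e : ℝ) ^ 2) / P ^ 2) by ring]
      have := div_le_div_of_nonneg_right h2 (sq_nonneg P)
      linarith
    have h4 : 2 * (T * Real.sqrt (2 * P) * (1 + Real.log (2 * P))) ^ 2 =
        4 * T ^ 2 * (1 + Real.log (2 * P)) ^ 2 * P := by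
      rw [mul_pow, mul_pow, hsq2P]; ring
    linarith
  -- assemble
  have hprod : (e : ℝ) *
          ((Y₀ / (e : ℝ) + 2) / (u₁ : ℝ) +
            (Nat.divisors u₁).card * Real.sqrt (u₁ : ℝ) * (1 + Real.log (u₁ : ℝ))) *
          ((Y₀ / (e : ℝ) + 2) / (v : ℝ) +
            (Nat.divisors v).card * Real.sqrt (v : ℝ) * (1 + Real.log (v : ℝ))) ≤
      (e : ℝ) * ((Y₀ + 2 * e) / P + T * Real.sqrt (2 * P) * (1 + Real.log (2 * P))) ^ 2 := by
    rw [sq, ← mul_assoc]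
    exact mul_le_mul (mul_le_mul_of_nonneg_left hB₁ he0R.le) hB₂ hB₂0
      (mul_nonneg he0R.le hβ0)
  have hprod0 : 0 ≤ (e : ℝ) *
          ((Y₀ / (e : ℝ) + 2) / (u₁ : ℝ) +
            (Nat.divisors u₁).card * Real.sqrt (u₁ : ℝ) * (1 + Real.log (u₁ : ℝ))) *
          ((Y₀ / (e : ℝ) + 2) / (v : ℝ) +
            (Nat.divisors v).card * Real.sqrt (v : ℝ) * (1 + Real.log (v : ℝ))) :=
    mul_nonneg (mul_nonneg he0R.le hB₁0) hB₂0
  have heβ : (e : ℝ) * ((Y₀ + 2 * e) / P + T * Real.sqrt (2 * P) * (1 + Real.log (2 * P))) ^ 2 ≤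
      (4 * (e : ℝ) * Y₀ ^ 2 + 16 * (e : ℝ) ^ 3) / P ^ 2 +
        4 * (e : ℝ) * T ^ 2 * (1 + Real.log (2 * P)) ^ 2 * P := by
    have := mul_le_mul_of_nonneg_left hβsq he0R.le
    refine this.trans (le_of_eq ?_)
    field_simp
  have key : ((Nat.divisors (u₁ * v)).card : ℝ) * ((e : ℝ) *
          ((Y₀ / (e : ℝ) + 2) / (u₁ : ℝ) +
            (Nat.divisors u₁).card * Real.sqrt (u₁ : ℝ) * (1 + Real.log (u₁ : ℝ))) *
          ((Y₀ / (e : ℝ) + 2) / (v : ℝ) +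
            (Nat.divisors v).card * Real.sqrt (v : ℝ) * (1 + Real.log (v : ℝ)))) ≤
      T ^ 2 * ((4 * (e : ℝ) * Y₀ ^ 2 + 16 * (e : ℝ) ^ 3) / P ^ 2 +
        4 * (e : ℝ) * T ^ 2 * (1 + Real.log (2 * P)) ^ 2 * P) :=
    (mul_le_mul hτ hprod hprod0 (sq_nonneg T)).trans (mul_le_mul_of_nonneg_left heβ (sq_nonneg T))
  have key2 := mul_le_mul_of_nonneg_left key hC
  have e1 : C * ((Nat.divisors (u₁ * v)).card : ℝ) * ((e : ℝ) *
          ((Y₀ / (e : ℝ) + 2) / (u₁ : ℝ) +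
            (Nat.divisors u₁).card * Real.sqrt (u₁ : ℝ) * (1 + Real.log (u₁ : ℝ))) *
          ((Y₀ / (e : ℝ) + 2) / (v : ℝ) +
            (Nat.divisors v).card * Real.sqrt (v : ℝ) * (1 + Real.log (v : ℝ)))) =
      C * (((Nat.divisors (u₁ * v)).card : ℝ) * ((e : ℝ) *
          ((Y₀ / (e : ℝ) + 2) / (u₁ : ℝ) +
            (Nat.divisors u₁).card * Real.sqrt (u₁ : ℝ) * (1 + Real.log (u₁ : ℝ))) *
          ((Y₀ / (e : ℝ) + 2) / (v : ℝ) +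
            (Nat.divisors v).card * Real.sqrt (v : ℝ) * (1 + Real.log (v : ℝ))))) := by ring
  have e2 : C * T ^ 2 * ((4 * (e : ℝ) * Y₀ ^ 2 + 16 * (e : ℝ) ^ 3) / P ^ 2 +
        4 * (e : ℝ) * T ^ 2 * (1 + Real.log (2 * P)) ^ 2 * P) =
      C * (T ^ 2 * ((4 * (e : ℝ) * Y₀ ^ 2 + 16 * (e : ℝ) ^ 3) / P ^ 2 +
        4 * (e : ℝ) * T ^ 2 * (1 + Real.log (2 * P)) ^ 2 * P)) := by ring
  rw [e1, e2]
  exact key2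

/-- **Multiples of `g` in `(P, 2P]`**: for `U ⊆ (P, 2P] ∩ ℕ` (`P ≥ 1`) and `1 ≤ g ≤ 2P`,
`#{u ∈ U : g ∣ u} ≤ P/g + 1 ≤ 3P/g`. [folklore] -/
theorem LD_card_filter_dvd_le {U : Finset ℕ} {P : ℝ} (hP : 1 ≤ P)
    (hU : ∀ u ∈ U, P < (u : ℝ) ∧ (u : ℝ) ≤ 2 * P) {g : ℕ} (hg : 1 ≤ g) (hg2 : (g : ℝ) ≤ 2 * P) :
    ((U.filter (fun u => g ∣ u)).card : ℝ) ≤ 3 * P / g := by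
  classical
  have hg0 : (0 : ℝ) < g := by exact_mod_cast hg
  have hP0 : 0 < P := by linarith
  -- `u ↦ u / g` maps the multiples injectively into `(⌊P/g⌋, ⌊2P/g⌋]`
  have hmaps : ∀ u ∈ U.filter (fun u => g ∣ u), u / g ∈ Finset.Ioc ⌊P / g⌋₊ ⌊2 * P / g⌋₊ := by
    intro u hu
    rw [Finset.mem_filter] at hu
    obtain ⟨huU, k, rfl⟩ := hu
    obtain ⟨h1, h2⟩ := hU _ huU
    rw [Nat.mul_div_cancel_left k hg, Finset.mem_Ioc]
    push_cast at h1 h2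
    constructor
    · rw [Nat.floor_lt (by positivity), div_lt_iff₀ hg0]
      linarith
    · rw [Nat.le_floor_iff (by positivity), le_div_iff₀ hg0]
      linarith
  have hinj : Set.InjOn (fun u => u / g) (U.filter (fun u => g ∣ u) : Set ℕ) := by
    intro a ha b hb hab
    simp only [Finset.coe_filter, Set.mem_setOf_eq] at ha hb
    obtain ⟨k, rfl⟩ := ha.2
    obtain ⟨k', rfl⟩ := hb.2
    simp only [Nat.mul_div_cancel_left _ hg] at hab
    rw [hab]
  have hcard := Finset.card_le_card_of_injOn (fun u => u / g) hmaps hinj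
  have hfl : ⌊P / g⌋₊ ≤ ⌊2 * P / g⌋₊ :=
    Nat.floor_le_floor (div_le_div_of_nonneg_right (by linarith) hg0.le)
  calc ((U.filter (fun u => g ∣ u)).card : ℝ) ≤ ((Finset.Ioc ⌊P / g⌋₊ ⌊2 * P / g⌋₊).card : ℝ) := by
        exact_mod_cast hcard
    _ = (⌊2 * P / g⌋₊ : ℝ) - (⌊P / g⌋₊ : ℝ) := by
        rw [Nat.card_Ioc, Nat.cast_sub hfl]
    _ ≤ 2 * P / g - (P / g - 1) := by
        have h1 : (⌊2 * P / g⌋₊ : ℝ) ≤ 2 * P / g := Nat.floor_le (by positivity)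
        have h2 : P / g < (⌊P / g⌋₊ : ℝ) + 1 := Nat.lt_floor_add_one _
        linarith
    _ = P / g + 1 := by ring
    _ ≤ 3 * P / g := by
        rw [div_add_one hg0.ne', div_le_div_iff_of_pos_right hg0]
        linarith

/-- **Pairs grouped by their gcd**: for `U ⊆ (P, 2P] ∩ ℕ` (`P ≥ 1`) and `f ≥ 0`,
`∑_{(u,u') ∈ U²} f((u,u')) ≤ ∑_{g=1}^{⌊2P⌋} f(g) (3P/g)²`. [folklore] -/
theorem LD_sum_pairs_gcd_le {U : Finset ℕ} {P : ℝ} (hP : 1 ≤ P)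
    (hU : ∀ u ∈ U, P < (u : ℝ) ∧ (u : ℝ) ≤ 2 * P) (f : ℕ → ℝ) (hf : ∀ g, 0 ≤ f g) :
    ∑ p ∈ U ×ˢ U, f (Nat.gcd p.1 p.2) ≤
      ∑ g ∈ Finset.Icc 1 ⌊2 * P⌋₊, f g * (3 * P / g) ^ 2 := by
  classical
  have hP0 : 0 < P := by linarith
  have hUpos : ∀ u ∈ U, 0 < u := by
    intro u hu
    have := (hU u hu).1
    exact_mod_cast hP0.trans this
  have hmaps : ∀ p ∈ U ×ˢ U, Nat.gcd p.1 p.2 ∈ Finset.Icc 1 ⌊2 * P⌋₊ := by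
    intro p hp
    rw [Finset.mem_product] at hp
    rw [Finset.mem_Icc]
    constructor
    · exact Nat.gcd_pos_of_pos_left _ (hUpos _ hp.1)
    · refine Nat.le_floor ?_
      have h1 : (Nat.gcd p.1 p.2 : ℝ) ≤ p.1 := by
        exact_mod_cast Nat.le_of_dvd (hUpos _ hp.1) (Nat.gcd_dvd_left _ _)
      exact h1.trans (hU _ hp.1).2
  rw [← Finset.sum_fiberwise_of_maps_to hmaps]
  refine Finset.sum_le_sum fun g hg => ?_
  rw [Finset.mem_Icc] at hg
  have hg2 : (g : ℝ) ≤ 2 * P := le_trans (by exact_mod_cast hg.2) (Nat.floor_le (by positivity))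
  have hcnt : (((U ×ˢ U).filter (fun p : ℕ × ℕ => Nat.gcd p.1 p.2 = g)).card : ℝ) ≤ (3 * P / g) ^ 2 := by
    have hsub : (U ×ˢ U).filter (fun p : ℕ × ℕ => Nat.gcd p.1 p.2 = g) ⊆
        (U.filter (fun u => g ∣ u)) ×ˢ (U.filter (fun u => g ∣ u)) := by
      intro p hp
      simp only [Finset.mem_filter, Finset.mem_product] at hp ⊢
      obtain ⟨⟨h1, h2⟩, h3⟩ := hp
      exact ⟨⟨h1, h3 ▸ Nat.gcd_dvd_left _ _⟩, ⟨h2, h3 ▸ Nat.gcd_dvd_right _ _⟩⟩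
    have hc := LD_card_filter_dvd_le hP hU hg.1 hg2
    calc (((U ×ˢ U).filter (fun p : ℕ × ℕ => Nat.gcd p.1 p.2 = g)).card : ℝ)
        ≤ (((U.filter (fun u => g ∣ u)) ×ˢ (U.filter (fun u => g ∣ u))).card : ℝ) := by
          exact_mod_cast Finset.card_le_card hsub
      _ = ((U.filter (fun u => g ∣ u)).card : ℝ) ^ 2 := by rw [Finset.card_product]; push_cast; ring
      _ ≤ (3 * P / g) ^ 2 := pow_le_pow_left₀ (Nat.cast_nonneg _) hc 2
  calc ∑ p ∈ (U ×ˢ U).filter (fun p : ℕ × ℕ => Nat.gcd p.1 p.2 = g), f (Nat.gcd p.1 p.2)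
      = ∑ p ∈ (U ×ˢ U).filter (fun p : ℕ × ℕ => Nat.gcd p.1 p.2 = g), f g :=
        Finset.sum_congr rfl fun p hp => by rw [(Finset.mem_filter.mp hp).2]
    _ = (((U ×ˢ U).filter (fun p : ℕ × ℕ => Nat.gcd p.1 p.2 = g)).card : ℝ) * f g := by
        rw [Finset.sum_const, nsmul_eq_mul]
    _ ≤ (3 * P / g) ^ 2 * f g := mul_le_mul_of_nonneg_right hcnt (hf g)
    _ = f g * (3 * P / g) ^ 2 := mul_comm _ _

/-- `∑_{(u,u') ∈ U²} (u,u') ≤ 9P² (1 + log 2P)` for `U ⊆ (P, 2P] ∩ ℕ`, `P ≥ 1`. [folklore] -/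
theorem LD_sum_pairs_gcd_one_le {U : Finset ℕ} {P : ℝ} (hP : 1 ≤ P)
    (hU : ∀ u ∈ U, P < (u : ℝ) ∧ (u : ℝ) ≤ 2 * P) :
    ∑ p ∈ U ×ˢ U, (Nat.gcd p.1 p.2 : ℝ) ≤ 9 * P ^ 2 * (1 + Real.log (2 * P)) := by
  have hP0 : 0 < P := by linarith
  refine (LD_sum_pairs_gcd_le hP hU (fun g => (g : ℝ)) (fun g => Nat.cast_nonneg g)).trans ?_
  have h1 : ∑ g ∈ Finset.Icc 1 ⌊2 * P⌋₊, (g : ℝ) * (3 * P / g) ^ 2 =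
      9 * P ^ 2 * ∑ g ∈ Finset.Icc 1 ⌊2 * P⌋₊, ((g : ℝ))⁻¹ := by
    rw [Finset.mul_sum]
    refine Finset.sum_congr rfl fun g hg => ?_
    rw [Finset.mem_Icc] at hg
    have hg0 : (g : ℝ) ≠ 0 := by exact_mod_cast (show g ≠ 0 by omega)
    field_simp
    ring
  rw [h1]
  refine mul_le_mul_of_nonneg_left ((harmonic_Icc_le _).trans ?_) (by positivity)
  rcases Nat.eq_zero_or_pos ⌊2 * P⌋₊ with h0 | h0
  · rw [h0]; simp; exact Real.log_nonneg (by linarith)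
  · have := Real.log_le_log (by exact_mod_cast h0 : (0 : ℝ) < ⌊2 * P⌋₊) (Nat.floor_le (by positivity))
    linarith

/-- `∑_{(u,u') ∈ U²} (u,u')³ ≤ 36 P⁴` for `U ⊆ (P, 2P] ∩ ℕ`, `P ≥ 1`. [folklore] -/
theorem LD_sum_pairs_gcd_cube_le {U : Finset ℕ} {P : ℝ} (hP : 1 ≤ P)
    (hU : ∀ u ∈ U, P < (u : ℝ) ∧ (u : ℝ) ≤ 2 * P) :
    ∑ p ∈ U ×ˢ U, (Nat.gcd p.1 p.2 : ℝ) ^ 3 ≤ 36 * P ^ 4 := by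
  have hP0 : 0 < P := by linarith
  refine (LD_sum_pairs_gcd_le hP hU (fun g => (g : ℝ) ^ 3) (fun g => by positivity)).trans ?_
  have h1 : ∑ g ∈ Finset.Icc 1 ⌊2 * P⌋₊, (g : ℝ) ^ 3 * (3 * P / g) ^ 2 =
      9 * P ^ 2 * ∑ g ∈ Finset.Icc 1 ⌊2 * P⌋₊, (g : ℝ) := by
    rw [Finset.mul_sum]
    refine Finset.sum_congr rfl fun g hg => ?_
    rw [Finset.mem_Icc] at hg
    have hg0 : (g : ℝ) ≠ 0 := by exact_mod_cast (show g ≠ 0 by omega)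
    field_simp
    ring
  rw [h1]
  have h2 : ∑ g ∈ Finset.Icc 1 ⌊2 * P⌋₊, (g : ℝ) ≤ (⌊2 * P⌋₊ : ℝ) * ⌊2 * P⌋₊ := by
    calc ∑ g ∈ Finset.Icc 1 ⌊2 * P⌋₊, (g : ℝ) ≤ ∑ g ∈ Finset.Icc 1 ⌊2 * P⌋₊, (⌊2 * P⌋₊ : ℝ) := by
          refine Finset.sum_le_sum fun g hg => ?_
          rw [Finset.mem_Icc] at hg
          exact_mod_cast hg.2
      _ = _ := by rw [Finset.sum_const, nsmul_eq_mul, Nat.card_Icc]; push_cast; ring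
  have h3 : (⌊2 * P⌋₊ : ℝ) ≤ 2 * P := Nat.floor_le (by positivity)
  have h4 : (⌊2 * P⌋₊ : ℝ) * ⌊2 * P⌋₊ ≤ (2 * P) * (2 * P) :=
    mul_le_mul h3 h3 (Nat.cast_nonneg _) (by positivity)
  nlinarith

/-- Double-sum form of `LD_sum_pairs_gcd_one_le`. [folklore] -/
theorem LD_sum_sum_gcd_le {U : Finset ℕ} {P : ℝ} (hP : 1 ≤ P)
    (hU : ∀ u ∈ U, P < (u : ℝ) ∧ (u : ℝ) ≤ 2 * P) :
    ∑ u ∈ U, ∑ u' ∈ U, (Nat.gcd u u' : ℝ) ≤ 9 * P ^ 2 * (1 + Real.log (2 * P)) := by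
  rw [← Finset.sum_product' (f := fun u u' => (Nat.gcd u u' : ℝ))]
  exact LD_sum_pairs_gcd_one_le hP hU

/-- Double-sum form of `LD_sum_pairs_gcd_cube_le`. [folklore] -/
theorem LD_sum_sum_gcd_cube_le {U : Finset ℕ} {P : ℝ} (hP : 1 ≤ P)
    (hU : ∀ u ∈ U, P < (u : ℝ) ∧ (u : ℝ) ≤ 2 * P) :
    ∑ u ∈ U, ∑ u' ∈ U, (Nat.gcd u u' : ℝ) ^ 3 ≤ 36 * P ^ 4 := by
  rw [← Finset.sum_product' (f := fun u u' => (Nat.gcd u u' : ℝ) ^ 3)]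
  exact LD_sum_pairs_gcd_cube_le hP hU

/-- The final numerical step of the engine: with `S = √(C₀C₂)`, `ℓ₀ = 1 + log 2P ≤ L`,
`4ST²(36Y₀²ℓ₀ + 576P² + 36T²ℓ₀³P³) ≤ (2448 S + 1) T⁴ L³ ((Q(Y₀+1))² + P³)`. [folklore] -/
theorem LD_final_numeric {S T P Qr L ℓ₀ Y₀ : ℝ} (hS : 0 ≤ S) (hT : 1 ≤ T) (hP : 1 ≤ P)
    (hQ : 1 ≤ Qr) (hℓ₀ : 1 ≤ ℓ₀) (hℓL : ℓ₀ ≤ L) (hY₀ : 0 ≤ Y₀) :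
    4 * S * T ^ 2 * (4 * Y₀ ^ 2 / P ^ 2) * (9 * P ^ 2 * ℓ₀) +
        4 * S * T ^ 2 * (16 / P ^ 2) * (36 * P ^ 4) +
        4 * S * T ^ 2 * (4 * T ^ 2 * ℓ₀ ^ 2 * P) * (9 * P ^ 2 * ℓ₀) ≤
      (2448 * S + 1) * T ^ 4 * L ^ 3 * ((Qr * (Y₀ + 1)) ^ 2 + P ^ 3) := by
  have hP0 : 0 < P := by linarith
  have hL1 : 1 ≤ L := le_trans hℓ₀ hℓL
  have hℓ0 : 0 ≤ ℓ₀ := by linarith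
  have hT0 : 0 ≤ T := by linarith
  have hLL3 : L ≤ L ^ 3 := le_self_pow₀ hL1 (by norm_num)
  have hℓL3 : ℓ₀ ≤ L ^ 3 := hℓL.trans hLL3
  have hL3 : 1 ≤ L ^ 3 := one_le_pow₀ hL1
  have hT24 : T ^ 2 ≤ T ^ 4 := pow_le_pow_right₀ hT (by norm_num)
  have hP23 : P ^ 2 ≤ P ^ 3 := pow_le_pow_right₀ hP (by norm_num)
  have hYQ : Y₀ ≤ Qr * (Y₀ + 1) := by nlinarith
  -- rewrite the left side
  have hLHS : 4 * S * T ^ 2 * (4 * Y₀ ^ 2 / P ^ 2) * (9 * P ^ 2 * ℓ₀) +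
        4 * S * T ^ 2 * (16 / P ^ 2) * (36 * P ^ 4) +
        4 * S * T ^ 2 * (4 * T ^ 2 * ℓ₀ ^ 2 * P) * (9 * P ^ 2 * ℓ₀) =
      144 * S * (Y₀ ^ 2 * ℓ₀ * T ^ 2) + 2304 * S * (P ^ 2 * T ^ 2) +
        144 * S * (T ^ 4 * ℓ₀ ^ 3 * P ^ 3) := by
    field_simp
    ring
  rw [hLHS]
  have h1 : Y₀ ^ 2 * ℓ₀ * T ^ 2 ≤ (Qr * (Y₀ + 1)) ^ 2 * L ^ 3 * T ^ 4 := by gcongr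
  have h2 : P ^ 2 * T ^ 2 ≤ P ^ 3 * L ^ 3 * T ^ 4 := by
    calc P ^ 2 * T ^ 2 = P ^ 2 * 1 * T ^ 2 := by ring
      _ ≤ P ^ 3 * L ^ 3 * T ^ 4 := by gcongr
  have h3 : T ^ 4 * ℓ₀ ^ 3 * P ^ 3 ≤ T ^ 4 * L ^ 3 * P ^ 3 := by gcongr
  have k1 := mul_le_mul_of_nonneg_left h1 (by positivity : (0 : ℝ) ≤ 144 * S)
  have k2 := mul_le_mul_of_nonneg_left h2 (by positivity : (0 : ℝ) ≤ 2304 * S)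
  have k3 := mul_le_mul_of_nonneg_left h3 (by positivity : (0 : ℝ) ≤ 144 * S)
  have hpos : 0 ≤ T ^ 4 * L ^ 3 * ((Qr * (Y₀ + 1)) ^ 2 + P ^ 3) := by positivity
  have hpos2 : 0 ≤ S * (T ^ 4 * L ^ 3 * (Qr * (Y₀ + 1)) ^ 2) := by positivity
  nlinarith [k1, k2, k3, hpos, hpos2]

/-- **The dispersion engine, `A ≥ 0`** (Linnik's dispersion method with Kloosterman fractions, in
the manner of BFI §§3–9 with Weil's bound in place of Deshouillers–Iwaniec).  Notation: moduli
`u ∈ U` squarefree, coprime to `A·B·Q`, `P < u ≤ 2P`, `τ(u) ≤ T`; coefficients `|α_u| ≤ 1`; the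
short variable `m = c_m + Qy`, `y₁ < y ≤ y₂`; the long variable `0 ≤ d ≤ 4R`, `d ≡ c_d (mod Q)`,
weighted by a smooth `F` supported in `[R/2, 4R]` with `|F| ≤ C₀`, `|F''| ≤ C₂R⁻²`.  Then
`𝒟 = ∑_d F(d) |∑_u α_u ∑_y [u ∣ Adm + B]|²` equals
`MT = (∫F)/Q · ∑_{u,u'} α_u ᾱ_{u'} N(u,u')/[u,u']` up to
`≤ K T⁴ (1 + log 2PQR)³ ((Q(y₂−y₁+1))² + P³)`, `K = 2448 √(C₀C₂) + 1`.
[cite: BombieriFriedlanderIwaniecActa1986, §3 (3.6)–(3.8), §6, §9] -/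
theorem LD_dispersion_engine_nat (A : ℕ) (B : ℤ) (C₀ C₂ : ℝ) :
    ∀ (Q : ℕ) (cd cm : ℤ) (P R T : ℝ) (y₁ y₂ : ℤ) (U : Finset ℕ) (α : ℕ → ℂ) (F : ℝ → ℝ),
      0 < Q → 1 ≤ P → 1 ≤ R → 1 ≤ T → y₁ ≤ y₂ →
      (∀ u ∈ U, Squarefree u ∧ Nat.Coprime u (A * B.natAbs * Q) ∧ P < (u : ℝ) ∧ (u : ℝ) ≤ 2 * P ∧
        ((Nat.divisors u).card : ℝ) ≤ T) →
      (∀ u, ‖α u‖ ≤ 1) →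
      ContDiff ℝ ((⊤ : ℕ∞) : WithTop ℕ∞) F → (∀ x, F x ≠ 0 → R / 2 ≤ x ∧ x ≤ 4 * R) →
      (∀ x, ‖F x‖ ≤ C₀) → (∀ x, ‖iteratedDeriv 2 F x‖ ≤ C₂ / R ^ 2) →
      ‖(∑ d ∈ (Finset.range (⌊4 * R⌋₊ + 1)).filter (fun d : ℕ => (d : ℤ) ≡ cd [ZMOD Q]),
          ((F d : ℝ) : ℂ) *
            (‖∑ u ∈ U, α u * ∑ y ∈ Finset.Ioc y₁ y₂,
                (if (u : ℤ) ∣ (A : ℤ) * d * (cm + Q * y) + B then (1 : ℂ) else 0)‖ : ℂ) ^ 2)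
        - ((∫ x, F x : ℝ) : ℂ) / (Q : ℂ) *
          ∑ u ∈ U, ∑ u' ∈ U, α u * (starRingEnd ℂ) (α u') *
            ((((Finset.Ioc y₁ y₂) ×ˢ (Finset.Ioc y₁ y₂)).filter (fun p : ℤ × ℤ =>
                Int.gcd (cm + Q * p.1) u = 1 ∧ Int.gcd (cm + Q * p.2) u' = 1 ∧
                cm + Q * p.1 ≡ cm + Q * p.2 [ZMOD (Nat.gcd u u' : ℕ)])).card : ℂ) /
            ((Nat.lcm u u' : ℕ) : ℂ)‖ ≤
        (2448 * Real.sqrt (C₀ * C₂) + 1) * T ^ 4 * (1 + Real.log (2 * P * Q * R)) ^ 3 *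
          (((Q : ℝ) * (((y₂ - y₁ : ℤ) : ℝ) + 1)) ^ 2 + P ^ 3) := by
  intro Q cd cm P R T y₁ y₂ U α F hQ hP hR hT hy hU hα hF hsupp hFC₀ hFC₂
  -- hypotheses on the moduli
  have hUall : ∀ u ∈ U, Squarefree u ∧ A.Coprime u ∧ Int.gcd B u = 1 ∧ Q.Coprime u ∧
      P < (u : ℝ) ∧ (u : ℝ) ≤ 2 * P ∧ ((Nat.divisors u).card : ℝ) ≤ T := by
    intro u hu
    obtain ⟨h1, h2, h3, h4, h5⟩ := hU u hu
    refine ⟨h1, (h2.coprime_mul_right_right.coprime_mul_right_right).symm, ?_,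
      h2.coprime_mul_left_right.symm, h3, h4, h5⟩
    have h6 : Nat.Coprime u B.natAbs := h2.coprime_mul_right_right.coprime_mul_left_right
    rw [Int.gcd, Int.natAbs_natCast]
    exact h6.symm
  have hUP : ∀ u ∈ U, P < (u : ℝ) ∧ (u : ℝ) ≤ 2 * P := fun u hu => ⟨(hU u hu).2.2.1, (hU u hu).2.2.2.1⟩
  have hR0 : 0 < R := by linarith
  have hP0 : 0 < P := by linarith
  have hF' : ContDiff ℝ ∞ F := hF
  have hy0 : (0 : ℝ) ≤ ((y₂ - y₁ : ℤ) : ℝ) := by exact_mod_cast (sub_nonneg.mpr hy)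
  -- abbreviations
  set ι : ℕ → ℕ → ℤ → ℂ := fun u d y =>
    if (u : ℤ) ∣ (A : ℤ) * d * (cm + Q * y) + B then (1 : ℂ) else 0 with hι
  set Dset : Finset ℕ := (Finset.range (⌊4 * R⌋₊ + 1)).filter (fun d : ℕ => (d : ℤ) ≡ cd [ZMOD Q])
    with hDset
  set Tf : ℕ → ℕ → ℂ := fun u u' => ∑ d ∈ Dset, ((F d : ℝ) : ℂ) *
    ((∑ y ∈ Finset.Ioc y₁ y₂, ι u d y) * (∑ y ∈ Finset.Ioc y₁ y₂, ι u' d y)) with hTf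
  set Nc : ℕ → ℕ → ℂ := fun u u' => ((((Finset.Ioc y₁ y₂) ×ˢ (Finset.Ioc y₁ y₂)).filter
    (fun p : ℤ × ℤ => Int.gcd (cm + Q * p.1) u = 1 ∧ Int.gcd (cm + Q * p.2) u' = 1 ∧
      cm + Q * p.1 ≡ cm + Q * p.2 [ZMOD (Nat.gcd u u' : ℕ)])).card : ℂ) with hNc
  set Mf : ℕ → ℕ → ℂ := fun u u' =>
    ((∫ x, F x : ℝ) : ℂ) / (Q : ℂ) * Nc u u' / ((Nat.lcm u u' : ℕ) : ℂ) with hMf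
  set S : ℝ := Real.sqrt (C₀ * C₂) with hS
  set ℓ₀ : ℝ := 1 + Real.log (2 * P) with hℓ₀
  set L : ℝ := 1 + Real.log (2 * P * Q * R) with hL
  show ‖(∑ d ∈ Dset, ((F d : ℝ) : ℂ) *
      (‖∑ u ∈ U, α u * ∑ y ∈ Finset.Ioc y₁ y₂, ι u d y‖ : ℂ) ^ 2) -
      ((∫ x, F x : ℝ) : ℂ) / (Q : ℂ) *
        ∑ u ∈ U, ∑ u' ∈ U, α u * (starRingEnd ℂ) (α u') * Nc u u' / ((Nat.lcm u u' : ℕ) : ℂ)‖ ≤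
      (2448 * S + 1) * T ^ 4 * L ^ 3 * (((Q : ℝ) * (((y₂ - y₁ : ℤ) : ℝ) + 1)) ^ 2 + P ^ 3)
  -- Step 1: expanding the square
  have hnormsq : ∀ z : ℂ, ((‖z‖ : ℂ)) ^ 2 = z * (starRingEnd ℂ) z := fun z => by
    rw [Complex.mul_conj, Complex.normSq_eq_norm_sq]; push_cast; ring
  have hconjY : ∀ u d, (starRingEnd ℂ) (∑ y ∈ Finset.Ioc y₁ y₂, ι u d y) =
      ∑ y ∈ Finset.Ioc y₁ y₂, ι u d y := by
    intro u d
    rw [map_sum]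
    refine Finset.sum_congr rfl fun y _ => ?_
    simp only [hι]
    split_ifs <;> simp
  have hsq : ∀ d : ℕ, ((‖∑ u ∈ U, α u * ∑ y ∈ Finset.Ioc y₁ y₂, ι u d y‖ : ℂ)) ^ 2 =
      ∑ u ∈ U, ∑ u' ∈ U, α u * (starRingEnd ℂ) (α u') *
        ((∑ y ∈ Finset.Ioc y₁ y₂, ι u d y) * (∑ y ∈ Finset.Ioc y₁ y₂, ι u' d y)) := by
    intro d
    rw [hnormsq, map_sum, Finset.sum_mul_sum]
    refine Finset.sum_congr rfl fun u _ => Finset.sum_congr rfl fun u' _ => ?_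
    rw [map_mul, hconjY]
    ring
  have hD : ∑ d ∈ Dset, ((F d : ℝ) : ℂ) *
        (‖∑ u ∈ U, α u * ∑ y ∈ Finset.Ioc y₁ y₂, ι u d y‖ : ℂ) ^ 2 =
      ∑ u ∈ U, ∑ u' ∈ U, α u * (starRingEnd ℂ) (α u') * Tf u u' := by
    calc ∑ d ∈ Dset, ((F d : ℝ) : ℂ) *
          (‖∑ u ∈ U, α u * ∑ y ∈ Finset.Ioc y₁ y₂, ι u d y‖ : ℂ) ^ 2
        = ∑ d ∈ Dset, ∑ u ∈ U, ∑ u' ∈ U, ((F d : ℝ) : ℂ) * (α u * (starRingEnd ℂ) (α u') *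
            ((∑ y ∈ Finset.Ioc y₁ y₂, ι u d y) * (∑ y ∈ Finset.Ioc y₁ y₂, ι u' d y))) := by
          refine Finset.sum_congr rfl fun d _ => ?_
          rw [hsq, Finset.mul_sum]
          exact Finset.sum_congr rfl fun u _ => by rw [Finset.mul_sum]
      _ = ∑ u ∈ U, ∑ d ∈ Dset, ∑ u' ∈ U, ((F d : ℝ) : ℂ) * (α u * (starRingEnd ℂ) (α u') *
            ((∑ y ∈ Finset.Ioc y₁ y₂, ι u d y) * (∑ y ∈ Finset.Ioc y₁ y₂, ι u' d y))) :=
          Finset.sum_comm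
      _ = ∑ u ∈ U, ∑ u' ∈ U, ∑ d ∈ Dset, ((F d : ℝ) : ℂ) * (α u * (starRingEnd ℂ) (α u') *
            ((∑ y ∈ Finset.Ioc y₁ y₂, ι u d y) * (∑ y ∈ Finset.Ioc y₁ y₂, ι u' d y))) :=
          Finset.sum_congr rfl fun u _ => Finset.sum_comm
      _ = _ := by
          refine Finset.sum_congr rfl fun u _ => Finset.sum_congr rfl fun u' _ => ?_
          rw [hTf]
          dsimp only
          rw [Finset.mul_sum]
          exact Finset.sum_congr rfl fun d _ => by ring
  have hM : ((∫ x, F x : ℝ) : ℂ) / (Q : ℂ) *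
        ∑ u ∈ U, ∑ u' ∈ U, α u * (starRingEnd ℂ) (α u') * Nc u u' / ((Nat.lcm u u' : ℕ) : ℂ) =
      ∑ u ∈ U, ∑ u' ∈ U, α u * (starRingEnd ℂ) (α u') * Mf u u' := by
    rw [Finset.mul_sum]
    refine Finset.sum_congr rfl fun u _ => ?_
    rw [Finset.mul_sum]
    refine Finset.sum_congr rfl fun u' _ => ?_
    rw [hMf]
    dsimp only
    ring
  have hdiff : (∑ d ∈ Dset, ((F d : ℝ) : ℂ) *
        (‖∑ u ∈ U, α u * ∑ y ∈ Finset.Ioc y₁ y₂, ι u d y‖ : ℂ) ^ 2) -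
      ((∫ x, F x : ℝ) : ℂ) / (Q : ℂ) *
        ∑ u ∈ U, ∑ u' ∈ U, α u * (starRingEnd ℂ) (α u') * Nc u u' / ((Nat.lcm u u' : ℕ) : ℂ) =
      ∑ u ∈ U, ∑ u' ∈ U, α u * (starRingEnd ℂ) (α u') * (Tf u u' - Mf u u') := by
    rw [hD, hM, ← Finset.sum_sub_distrib]
    refine Finset.sum_congr rfl fun u _ => ?_
    rw [← Finset.sum_sub_distrib]
    exact Finset.sum_congr rfl fun u' _ => by ring
  rw [hdiff]
  -- Step 2: the pair bounds
  have hpair : ∀ u ∈ U, ∀ u' ∈ U, ‖Tf u u' - Mf u u'‖ ≤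
      4 * S * T ^ 2 * ((4 * (Nat.gcd u u' : ℝ) * ((y₂ - y₁ : ℤ) : ℝ) ^ 2 +
        16 * (Nat.gcd u u' : ℝ) ^ 3) / P ^ 2 +
        4 * (Nat.gcd u u' : ℝ) * T ^ 2 * (1 + Real.log (2 * P)) ^ 2 * P) := by
    intro u hu u' hu'
    obtain ⟨hsf, hAu, hBu, hQu, hPu, huP, hτu⟩ := hUall u hu
    obtain ⟨hsf', hAu', hBu', hQu', hPu', hu'P, hτu'⟩ := hUall u' hu'
    obtain ⟨hu'e, -, -, he0, hv0, hue, -⟩ := DK_gcd_facts hsf hsf'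
    have hu₁0 : 0 < u / Nat.gcd u u' :=
      Nat.div_pos (Nat.le_of_dvd (Nat.pos_of_ne_zero hsf.ne_zero) (Nat.gcd_dvd_left u u')) he0
    have h1 := LD_pair_dispersion_le hQ hsf hsf' hAu hAu' hBu hBu' hQu hQu' hR0 hF' hsupp hFC₀ hFC₂
      cd cm y₁ y₂ hy
    have h2 := LD_pair_bound_le (C := 4 * Real.sqrt (C₀ * C₂)) (Y₀ := ((y₂ - y₁ : ℤ) : ℝ)) hP hT
      (by positivity) hy0 hue hu'e he0 hu₁0 hv0 (Nat.coprime_div_gcd_div_gcd he0) hPu huP hPu' hu'P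
      hτu hτu'
    exact h1.trans h2
  -- Step 3: summing over the pairs
  have hsum : ∑ u ∈ U, ∑ u' ∈ U,
      4 * S * T ^ 2 * ((4 * (Nat.gcd u u' : ℝ) * ((y₂ - y₁ : ℤ) : ℝ) ^ 2 +
        16 * (Nat.gcd u u' : ℝ) ^ 3) / P ^ 2 +
        4 * (Nat.gcd u u' : ℝ) * T ^ 2 * (1 + Real.log (2 * P)) ^ 2 * P) =
      4 * S * T ^ 2 * (4 * ((y₂ - y₁ : ℤ) : ℝ) ^ 2 / P ^ 2) * ∑ u ∈ U, ∑ u' ∈ U, (Nat.gcd u u' : ℝ) +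
      4 * S * T ^ 2 * (16 / P ^ 2) * ∑ u ∈ U, ∑ u' ∈ U, (Nat.gcd u u' : ℝ) ^ 3 +
      4 * S * T ^ 2 * (4 * T ^ 2 * ℓ₀ ^ 2 * P) * ∑ u ∈ U, ∑ u' ∈ U, (Nat.gcd u u' : ℝ) := by
    have hterm : ∀ u u' : ℕ,
        4 * S * T ^ 2 * ((4 * (Nat.gcd u u' : ℝ) * ((y₂ - y₁ : ℤ) : ℝ) ^ 2 +
          16 * (Nat.gcd u u' : ℝ) ^ 3) / P ^ 2 +
          4 * (Nat.gcd u u' : ℝ) * T ^ 2 * (1 + Real.log (2 * P)) ^ 2 * P) =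
        4 * S * T ^ 2 * (4 * ((y₂ - y₁ : ℤ) : ℝ) ^ 2 / P ^ 2) * (Nat.gcd u u' : ℝ) +
        4 * S * T ^ 2 * (16 / P ^ 2) * (Nat.gcd u u' : ℝ) ^ 3 +
        4 * S * T ^ 2 * (4 * T ^ 2 * ℓ₀ ^ 2 * P) * (Nat.gcd u u' : ℝ) := by
      intro u u'; rw [hℓ₀]; ring
    simp only [hterm, Finset.sum_add_distrib, ← Finset.mul_sum]
  have hS0 : 0 ≤ S := Real.sqrt_nonneg _
  have hℓ₀1 : 1 ≤ ℓ₀ := by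
    have := Real.log_nonneg (show (1 : ℝ) ≤ 2 * P by linarith); rw [hℓ₀]; linarith
  have hQ1 : (1 : ℝ) ≤ Q := by exact_mod_cast hQ
  have hℓL : ℓ₀ ≤ L := by
    rw [hℓ₀, hL]
    have h1 : 2 * P ≤ 2 * P * Q * R := by
      have : (1 : ℝ) ≤ (Q : ℝ) * R := by nlinarith
      nlinarith
    have := Real.log_le_log (by linarith) h1
    linarith
  calc ‖∑ u ∈ U, ∑ u' ∈ U, α u * (starRingEnd ℂ) (α u') * (Tf u u' - Mf u u')‖
      ≤ ∑ u ∈ U, ‖∑ u' ∈ U, α u * (starRingEnd ℂ) (α u') * (Tf u u' - Mf u u')‖ := norm_sum_le _ _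
    _ ≤ ∑ u ∈ U, ∑ u' ∈ U, ‖α u * (starRingEnd ℂ) (α u') * (Tf u u' - Mf u u')‖ :=
        Finset.sum_le_sum fun u _ => norm_sum_le _ _
    _ ≤ ∑ u ∈ U, ∑ u' ∈ U, ‖Tf u u' - Mf u u'‖ := by
        refine Finset.sum_le_sum fun u _ => Finset.sum_le_sum fun u' _ => ?_
        rw [norm_mul, norm_mul, RCLike.norm_conj]
        calc ‖α u‖ * ‖α u'‖ * ‖Tf u u' - Mf u u'‖ ≤ 1 * 1 * ‖Tf u u' - Mf u u'‖ :=
              mul_le_mul_of_nonneg_right (mul_le_mul (hα u) (hα u') (norm_nonneg _) zero_le_one)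
                (norm_nonneg _)
          _ = ‖Tf u u' - Mf u u'‖ := by ring
    _ ≤ ∑ u ∈ U, ∑ u' ∈ U,
          4 * S * T ^ 2 * ((4 * (Nat.gcd u u' : ℝ) * ((y₂ - y₁ : ℤ) : ℝ) ^ 2 +
            16 * (Nat.gcd u u' : ℝ) ^ 3) / P ^ 2 +
            4 * (Nat.gcd u u' : ℝ) * T ^ 2 * (1 + Real.log (2 * P)) ^ 2 * P) :=
        Finset.sum_le_sum fun u hu => Finset.sum_le_sum fun u' hu' => hpair u hu u' hu'
    _ = _ := hsum
    _ ≤ 4 * S * T ^ 2 * (4 * ((y₂ - y₁ : ℤ) : ℝ) ^ 2 / P ^ 2) * (9 * P ^ 2 * ℓ₀) +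
          4 * S * T ^ 2 * (16 / P ^ 2) * (36 * P ^ 4) +
          4 * S * T ^ 2 * (4 * T ^ 2 * ℓ₀ ^ 2 * P) * (9 * P ^ 2 * ℓ₀) := by
        have g1 := LD_sum_sum_gcd_le hP hUP
        have g3 := LD_sum_sum_gcd_cube_le hP hUP
        rw [← hℓ₀] at g1
        gcongr
    _ ≤ (2448 * S + 1) * T ^ 4 * L ^ 3 * (((Q : ℝ) * (((y₂ - y₁ : ℤ) : ℝ) + 1)) ^ 2 + P ^ 3) :=
        LD_final_numeric hS0 hT hP hQ1 hℓ₀1 hℓL hy0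

/-- **The dispersion engine** (Linnik's dispersion method with Kloosterman fractions; the
`ℛ₁`-analysis of Bombieri–Friedlander–Iwaniec §§3–9 with Weil's bound).  For nonzero integers
`A, B` and `C₀, C₂ ≥ 0` there is `K = K(C₀, C₂) > 0` such that, for moduli `u ∈ U` squarefree,
coprime to `A·B·Q`, `P < u ≤ 2P`, `τ(u) ≤ T`, coefficients `|α_u| ≤ 1`, the short variable
`m = c_m + Qy` (`y₁ < y ≤ y₂`), the long variable `0 ≤ d ≤ 4R`, `d ≡ c_d (mod Q)`, weighted by a
smooth `F ≥ 0` supported in `[R/2, 4R]` with `|F| ≤ C₀`, `|F''| ≤ C₂R⁻²` (`P, R, T ≥ 1`):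
`|𝒟 − MT| ≤ K T⁴ (1 + log 2PQR)³ ((Q(y₂−y₁+1))² + P³)`, where
`𝒟 = ∑_{d ≡ c_d (Q)} F(d) |∑_u α_u ∑_y [u ∣ A d m + B]|²` and
`MT = (∫F)/Q · ∑_{u,u'} α_u ᾱ_{u'} N(u,u')/[u,u']`,
`N(u,u') = #{(y,y') : (m,u) = (m',u') = 1, m ≡ m' (mod (u,u'))}`.
(From `LD_dispersion_engine_nat` by the symmetry `(A, B) ↦ (−A, −B)`.)
[cite: BombieriFriedlanderIwaniecActa1986, §3 (3.6)–(3.8), §6, §9] -/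
theorem LD_dispersion_engine (A B : ℤ) (C₀ C₂ : ℝ) (hA : A ≠ 0) (_hB : B ≠ 0) (_hC₀ : 0 ≤ C₀)
    (_hC₂ : 0 ≤ C₂) :
    ∃ K : ℝ, 0 < K ∧
    ∀ (Q : ℕ) (cd cm : ℤ) (P R T : ℝ) (y₁ y₂ : ℤ) (U : Finset ℕ) (α : ℕ → ℂ) (F : ℝ → ℝ),
      0 < Q → 1 ≤ P → 1 ≤ R → 1 ≤ T → y₁ ≤ y₂ →
      (∀ u ∈ U, Squarefree u ∧ Nat.Coprime u (Int.natAbs A * Int.natAbs B * Q) ∧ P < (u : ℝ) ∧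
        (u : ℝ) ≤ 2 * P ∧
        ((Nat.divisors u).card : ℝ) ≤ T) →
      (∀ u, ‖α u‖ ≤ 1) →
      ContDiff ℝ ((⊤ : ℕ∞) : WithTop ℕ∞) F → (∀ x, F x ≠ 0 → R / 2 ≤ x ∧ x ≤ 4 * R) → (∀ x, 0 ≤ F x) →
      (∀ x, ‖F x‖ ≤ C₀) → (∀ x, ‖iteratedDeriv 2 F x‖ ≤ C₂ / R ^ 2) →
      ‖(∑ d ∈ (Finset.range (⌊4 * R⌋₊ + 1)).filter (fun d : ℕ => (d : ℤ) ≡ cd [ZMOD Q]),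
          ((F d : ℝ) : ℂ) *
            (‖∑ u ∈ U, α u * ∑ y ∈ Finset.Ioc y₁ y₂,
                (if (u : ℤ) ∣ A * d * (cm + Q * y) + B then (1 : ℂ) else 0)‖ : ℂ) ^ 2)
        - ((∫ x, F x : ℝ) : ℂ) / (Q : ℂ) *
          ∑ u ∈ U, ∑ u' ∈ U, α u * (starRingEnd ℂ) (α u') *
            ((((Finset.Ioc y₁ y₂) ×ˢ (Finset.Ioc y₁ y₂)).filter (fun p : ℤ × ℤ =>
                Int.gcd (cm + Q * p.1) u = 1 ∧ Int.gcd (cm + Q * p.2) u' = 1 ∧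
                cm + Q * p.1 ≡ cm + Q * p.2 [ZMOD (Nat.gcd u u' : ℕ)])).card : ℂ) /
            ((Nat.lcm u u' : ℕ) : ℂ)‖ ≤
        K * T ^ 4 * (1 + Real.log (2 * P * Q * R)) ^ 3 *
          (((Q : ℝ) * ((y₂ - y₁ : ℤ) + 1)) ^ 2 + P ^ 3) := by
  refine ⟨2448 * Real.sqrt (C₀ * C₂) + 1, by positivity, ?_⟩
  intro Q cd cm P R T y₁ y₂ U α F hQ hP hR hT hy hU hα hF hsupp _ hFC₀ hFC₂
  rcases lt_or_gt_of_ne hA with hneg | hpos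
  · -- `A < 0`: replace `(A, B)` by `(−A, −B)`
    obtain ⟨a, ha⟩ := Int.exists_eq_neg_ofNat hneg.le
    subst ha
    have hU' : ∀ u ∈ U, Squarefree u ∧ Nat.Coprime u (a * (-B).natAbs * Q) ∧ P < (u : ℝ) ∧
        (u : ℝ) ≤ 2 * P ∧ ((Nat.divisors u).card : ℝ) ≤ T := by
      intro u hu
      obtain ⟨h1, h2, h3, h4, h5⟩ := hU u hu
      refine ⟨h1, ?_, h3, h4, h5⟩
      simpa [Int.natAbs_neg] using h2
    have key := LD_dispersion_engine_nat a (-B) C₀ C₂ Q cd cm P R T y₁ y₂ U α F hQ hP hR hT hy hU' hα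
      hF hsupp hFC₀ hFC₂
    have hdvd : ∀ (u : ℕ) (d : ℕ) (y : ℤ), ((u : ℤ) ∣ -(a : ℤ) * d * (cm + Q * y) + B) ↔
        ((u : ℤ) ∣ (a : ℤ) * d * (cm + Q * y) + -B) := by
      intro u d y
      rw [← dvd_neg, show -(-(a : ℤ) * d * (cm + Q * y) + B) = (a : ℤ) * d * (cm + Q * y) + -B by ring]
    simp_rw [hdvd]
    exact key
  · -- `A > 0`
    obtain ⟨a, ha⟩ := Int.eq_ofNat_of_zero_le hpos.le
    subst ha
    have hU' : ∀ u ∈ U, Squarefree u ∧ Nat.Coprime u (a * B.natAbs * Q) ∧ P < (u : ℝ) ∧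
        (u : ℝ) ≤ 2 * P ∧ ((Nat.divisors u).card : ℝ) ≤ T := by
      intro u hu
      obtain ⟨h1, h2, h3, h4, h5⟩ := hU u hu
      refine ⟨h1, ?_, h3, h4, h5⟩
      simpa using h2
    exact LD_dispersion_engine_nat a B C₀ C₂ Q cd cm P R T y₁ y₂ U α F hQ hP hR hT hy hU' hα
      hF hsupp hFC₀ hFC₂

end Literature.NumberTheory.Sieve

end
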